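import Summits.Ventures.CertifiedManyBodySolver.Downfold.EmeryAxialOrbitalWeight
import Summits.Ventures.CertifiedManyBodySolver.Downfold.EmeryBilayerMirror
import HarnessLib

/-!
# THE BILAYER SPLITTING IS `2t⊥_ss ×` THE Cu-4s WEIGHT (to first order): on a Fermi point of one mirror sheet the other sheet's secular function is
# `2t⊥_ss·minor4S − 4t_sp t⊥_sp·axialLin` EXACTLY, so for pure `s–s` interlayer coupling the Newton step to the other sheet is `∓2t⊥_ss·w_s(k)` —
# zero at the node, maximal at the antinode, and equal to `2t⊥_ss·(1 − t⁽⁴⁾/t_σ)` = `2t⊥_ss·(δ₄ − δ_σ)/(1 + δ₄)` at the antinode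

Venture CertifiedManyBodySolver, cell `pub/hubbard-downfold` (stage S1; INFLATION-RULES-3to1-B §B.79 — the `tperp/t` row of the bilayer boxes M257 Hg-1212, M260 Tl-2212,
#33 Bi-2212, #18 YBa₂Cu₃O₇ read against the SAME axial quantity as the antinodal form defect and the U-leg dilution), seat hubbard-downfold-mod-4 (technique B, g31);
namespace `Summit.Ventures.CertifiedManyBodySolver.Downfold.Emery`. Sequel of `EmeryBilayerMirror` (the mirror sectors of the bilayer are single layers with
`(ε_s ± t⊥_ss, t_sp ± t⊥_sp)`; the splitting vanishes identically on the diagonal) and `EmeryAxialOrbitalWeight` (§B.78: `w_s = minor4S/dsec4 = |ψ_s|²`,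
`w_s = 1 − t⁽⁴⁾/t_σ`, `w_s(an) = (δ₄ − δ_σ)/(1 + δ₄)`). Everything PROVED (0 sorry; `ring` + the §B.78 identities). WHAT THIS IS NOT: a statement about any material;
interlayer `p–p`/`d–d` hoppings and dimpling are not modelled; the Newton step is the FIRST-ORDER splitting (Hellmann–Feynman `∂E/∂ε_s = w_s`), not the exact root
difference.

* §1 `sec4_axial_shift` (exact, `ring`): `sec4(ε_s + δ, T + θ) = sec4(ε_s, T) + δ·charCubic + θ·axialLin` — the four-orbital secular function is AFFINE in the axial
  level AND in `T = t_sp²`. Hence ON THE EVEN SHEET (`sec4(ε_s + t⊥_ss, (t_sp + t⊥_sp)²) = 0`) the odd sector's secular function is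
  **`sec4_odd = 2t⊥_ss·minor4S − 4t_sp t⊥_sp·axialLin`** (`sec4_odd_on_even_sheet`), and symmetrically (`sec4_even_on_odd_sheet`).
* §2 PURE `s–s` COUPLING (`t⊥_sp = 0`): the Newton step from a Fermi point of the even sheet toward the odd band is **`−2t⊥_ss·w_s^{odd}(k)`**
  (`bilayer_newton_split_even`), from the odd sheet toward the even band `+2t⊥_ss·w_s^{even}(k)` (`bilayer_newton_split_odd`): THE LINEARISED BILAYER
  SPLITTING IS TWICE THE INTERLAYER HOPPING TIMES THE Cu-4s WEIGHT — the `v²`-profile of [AndersenEtAl1995, Eq. (24)] with the direct O–O hoppings included,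
  made quantitative: zero at the node (`bilayer_newton_split_node`, exact: both sheets pass through the nodal point), and by §B.78 §5 equal to
  `2t⊥_ss·(1 − t⁽⁴⁾(k)/t_σ(k))` along the sheet and `2t⊥_ss·(δ₄ − δ_σ)/(1 + δ₄)` at the antinode — ONE axial quantity read three ways (splitting, velocity deficit,
  form-defect share).

Sources: [AndersenEtAl1995, Eq. (7), Eqs. (24)–(25)]; [PavariniEtAl2001, Eqs. (1)–(3) («This same v²-dependence pertains to the interlayer splitting»)];
[folklore] algebra.
-/

noncomputable section

namespace Summit.Ventures.CertifiedManyBodySolver.Downfold.Emery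

open Real

/-! ## §1 The secular function is affine in the axial level and in `t_sp²` -/

/-- `sec4(ε_s + δ, T + θ) = sec4(ε_s, T) + δ·charCubic + θ·axialLin` (exact). [folklore] -/
theorem sec4_axial_shift (Δ εs tpd tpp c T x y ε δ θ : ℝ) :
    sec4 Δ (εs + δ) tpd tpp c (T + θ) x y ε = sec4 Δ εs tpd tpp c T x y ε + δ * charCubic Δ tpd tpp c x y ε + θ * axialLin Δ tpd tpp c x y ε := by
  unfold sec4; ring

/-- **ON THE EVEN SHEET the odd sector's secular function is `2t⊥_ss·minor4S − 4t_sp t⊥_sp·axialLin`** (exact). [cite: AndersenEtAl1995, Eq. (7)] -/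
theorem sec4_odd_on_even_sheet {Δ εs tpd tpp c tsp tss tspP x y ε : ℝ} (h : sec4 Δ (εs + tss) tpd tpp c ((tsp + tspP) ^ 2) x y ε = 0) :
    sec4 Δ (εs - tss) tpd tpp c ((tsp - tspP) ^ 2) x y ε = 2 * tss * minor4S Δ tpd tpp c x y ε - 4 * tsp * tspP * axialLin Δ tpd tpp c x y ε := by
  have e := sec4_axial_shift Δ (εs + tss) tpd tpp c ((tsp + tspP) ^ 2) x y ε (-2 * tss) ((tsp - tspP) ^ 2 - (tsp + tspP) ^ 2)
  have e1 : εs + tss + -2 * tss = εs - tss := by ring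
  have e2 : (tsp + tspP) ^ 2 + ((tsp - tspP) ^ 2 - (tsp + tspP) ^ 2) = (tsp - tspP) ^ 2 := by ring
  rw [e1, e2, h, zero_add] at e
  rw [e]; unfold minor4S; ring

/-- Symmetrically ON THE ODD SHEET: `sec4_even = −2t⊥_ss·minor4S + 4t_sp t⊥_sp·axialLin`. [cite: AndersenEtAl1995, Eq. (7)] -/
theorem sec4_even_on_odd_sheet {Δ εs tpd tpp c tsp tss tspP x y ε : ℝ} (h : sec4 Δ (εs - tss) tpd tpp c ((tsp - tspP) ^ 2) x y ε = 0) :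
    sec4 Δ (εs + tss) tpd tpp c ((tsp + tspP) ^ 2) x y ε = -2 * tss * minor4S Δ tpd tpp c x y ε + 4 * tsp * tspP * axialLin Δ tpd tpp c x y ε := by
  have e := sec4_axial_shift Δ (εs - tss) tpd tpp c ((tsp - tspP) ^ 2) x y ε (2 * tss) ((tsp + tspP) ^ 2 - (tsp - tspP) ^ 2)
  have e1 : εs - tss + 2 * tss = εs + tss := by ring
  have e2 : (tsp - tspP) ^ 2 + ((tsp + tspP) ^ 2 - (tsp - tspP) ^ 2) = (tsp + tspP) ^ 2 := by ring
  rw [e1, e2, h, zero_add] at e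
  rw [e]; unfold minor4S; ring

/-! ## §2 Pure `s–s` coupling: the linearised splitting is `2t⊥_ss ×` the Cu-4s weight -/

/-- **FROM THE EVEN SHEET**: with `t⊥_sp = 0`, at a point of the even sheet the Newton step toward the odd band is `−2t⊥_ss·w_s^{odd}(k)`
(`w_s^{odd} = sWeight4` at the odd axial level `ε_s − t⊥_ss`; odd energy denominator `≠ 0`). [cite: AndersenEtAl1995, Eq. (24)] -/
theorem bilayer_newton_split_even {Δ εs tpd tpp c tsp tss x y ε : ℝ} (h : sec4 Δ (εs + tss) tpd tpp c (tsp ^ 2) x y ε = 0)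
    (hW : dsec4 Δ (εs - tss) tpd tpp c (tsp ^ 2) x y ε ≠ 0) :
    -sec4 Δ (εs - tss) tpd tpp c (tsp ^ 2) x y ε / dsec4 Δ (εs - tss) tpd tpp c (tsp ^ 2) x y ε =
      -2 * tss * sWeight4 Δ (εs - tss) tpd tpp c (tsp ^ 2) x y ε := by
  have h' : sec4 Δ (εs + tss) tpd tpp c ((tsp + 0) ^ 2) x y ε = 0 := by rwa [add_zero]
  have e := sec4_odd_on_even_sheet h'
  rw [sub_zero] at e
  rw [e]; unfold sWeight4; field_simp; ring

/-- **FROM THE ODD SHEET**: with `t⊥_sp = 0`, at a point of the odd sheet the Newton step toward the even band is `+2t⊥_ss·w_s^{even}(k)`. [cite: AndersenEtAl1995, Eq. (24)] -/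
theorem bilayer_newton_split_odd {Δ εs tpd tpp c tsp tss x y ε : ℝ} (h : sec4 Δ (εs - tss) tpd tpp c (tsp ^ 2) x y ε = 0)
    (hW : dsec4 Δ (εs + tss) tpd tpp c (tsp ^ 2) x y ε ≠ 0) :
    -sec4 Δ (εs + tss) tpd tpp c (tsp ^ 2) x y ε / dsec4 Δ (εs + tss) tpd tpp c (tsp ^ 2) x y ε =
      2 * tss * sWeight4 Δ (εs + tss) tpd tpp c (tsp ^ 2) x y ε := by
  have h' : sec4 Δ (εs - tss) tpd tpp c ((tsp - 0) ^ 2) x y ε = 0 := by rwa [sub_zero]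
  have e := sec4_even_on_odd_sheet h'
  rw [add_zero] at e
  rw [e]; unfold sWeight4; field_simp; ring

/-- AT THE NODE BOTH SHEETS COINCIDE (exact, any `t⊥_sp`): if the nodal point `(xNode, xNode)` of the σ set lies on one sheet's contour of the direct couplings,
the other sector's secular function vanishes there too — `minor4S = −charCubic` and `axialLin` are both zero at a diagonal σ-contour point (`fsN1 ≠ 0`).
[cite: AndersenEtAl1995, Eq. (24) (the `v²` node)] -/
theorem bilayer_newton_split_node {Δ εs tpd tpp c tsp tss tspP ε : ℝ} (hN1 : fsN1 tpd tpp c ε ≠ 0)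
    (h : sec4 Δ (εs + tss) tpd tpp c ((tsp + tspP) ^ 2) (xNode Δ tpd tpp c ε) (xNode Δ tpd tpp c ε) ε = 0) :
    sec4 Δ (εs - tss) tpd tpp c ((tsp - tspP) ^ 2) (xNode Δ tpd tpp c ε) (xNode Δ tpd tpp c ε) ε = 0 := by
  rw [sec4_odd_on_even_sheet h, axialLin_xNode hN1]
  unfold minor4S
  rw [charCubic_xNode (Δ := Δ) hN1]; ring

/-- THE SPLITTING AS A VELOCITY DEFICIT (fixed-Fermi-surface split of the ODD sector: frozen `t̄`, direct `t̄ − α`, `t_sp² = α(ε_s − t⊥_ss − ε)`): from a point of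
the even sheet that is a frozen-σ contour point, the Newton step is `−2t⊥_ss·(1 − t⁽⁴⁾_odd(k)/t_σ(k))` (`ε ≠ ε_s − t⊥_ss`, non-zero denominators). [folklore] -/
theorem bilayer_newton_split_eq_velocity_deficit {Δ εs tpd tpp c tsp tss α x y ε : ℝ}
    (h : sec4 Δ (εs + tss) tpd (tpp - α) (c - α) (tsp ^ 2) x y ε = 0) (hε : εs - tss - ε ≠ 0) (hT : tsp ^ 2 = α * (εs - tss - ε))
    (hP : charCubic Δ tpd tpp c x y ε = 0) (hTf : fsT Δ tpd tpp c ε ≠ 0) (hW4 : W4 Δ tpd tpp c (α / (εs - tss - ε)) x y ε ≠ 0)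
    (hW : dsec4 Δ (εs - tss) tpd (tpp - α) (c - α) (tsp ^ 2) x y ε ≠ 0) :
    -sec4 Δ (εs - tss) tpd (tpp - α) (c - α) (tsp ^ 2) x y ε / dsec4 Δ (εs - tss) tpd (tpp - α) (c - α) (tsp ^ 2) x y ε =
      -2 * tss * (1 - scaleT4 Δ tpd tpp c (α / (εs - tss - ε)) x y ε / scaleT Δ tpd tpp c x y ε) := by
  rw [bilayer_newton_split_even h hW, sWeight4_eq_one_sub_scale_ratio hε hT hP hTf hW4]

end Summit.Ventures.CertifiedManyBodySolver.Downfold.Emery
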